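/-
Copyright (c) 2026. All rights reserved.
Released under Apache 2.0 license as described in the file LICENSE.
Authors: abc-iut cell — seat abc-iut-w4-d071 (wave 4, gen 4; T54 binder board: the EDGELESS case of
[SemiAnbd] Thm 5.4 (i)(ii) at the outer model, for EVERY outer action — the complement of the hcof-free route).
-/
import Literature.AnabelianGeometry.SemiGraphs.ArithThm54AtAffWitness
import Literature.AnabelianGeometry.SemiGraphs.ArithDecompositionData
import Literature.AnabelianGeometry.SemiGraphs.ArithTemperedGroupOfOuterAction
import Literature.AnabelianGeometry.SemiGraphs.TemperedPiVerticialLevelData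
import Literature.AnabelianGeometry.SemiGraphs.ArithLevelKernelEdgelessObstruction
import HarnessLib

/-!
# [SemiAnbd] Thm 5.4 (i)(ii) p. 66 at the outer model `π₁^temp(𝒢) ⋊^out Π_A` of a ONE-VERTEX EDGELESS
# `𝒢`, for EVERY outer action `ρ` (proof-only)

Mochizuki, *Semi-graphs of anabelioids*, Publ. RIMS **42** (2006), §5 Def 5.1 (i) p. 62, Def 5.3 / Rmk 5.3.1
p. 65, Thm 5.4 (i)(ii) p. 66, Ex 5.6 p. 67 (a pointed stable curve with SMOOTH special fibre has the
one-vertex edgeless dual semi-graph; its arithmetic semi-graph of anabelioids carries the — in general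
highly non-trivial — outer Galois action on `Π_v`); the author's Comments (2020) (4) (the case `A` trivial,
"`Π^temp_𝔊` itself is a verticial subgroup … assertions (i), (ii) … are, in essence, vacuous").
[cite: MochizukiSemiAnbd2006, Thm 5.4 (i) p.66]

PROOF-ONLY file (abc-iut cell, layer L3, row T54-B; seat abc-iut-w4-d071 gen 4; no `def`, no named fact,
no instance).  CONTEXT (T54 binder board α97): the hcof-free route to the capstone of Thm 5.4 (i)
(abc-iut-w4-d085: p438023 / p438510 / p439125 / p441537) proves its residual «hUρ» from faithfulness of
`π₁^temp(𝒢)` on the finite coset levels, obtained from a compatible BRANCH-PAIR system — so it needs an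
EDGE; at one-vertex edgeless data «hUρ» is EQUIVALENT to `ρ = 1` (`ArithLevelKernelEdgelessObstruction`,
p441067).  This file closes the complementary case DIRECTLY, for every `ρ`:

* (reused from abc-iut-f-156's `ArithThm54AtAffWitness`: `arithVertGp_eq_top_of_Hv_eq_top` — for a
  chart representative with `R.Hv v = ⊤` and an embedding with NORMAL image the arithmetic vertex group,
  the commensurator of `ι(Π_v)` p. 65, is ALL of `Gtp`; f-156 proved the affWitness case of everything
  below — this file removes the restriction to that one witness);
* `arithMaximalCompactStatementI_outerModel_of_edgeless` — **Thm 5.4 (i) as typed holds at the outer model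
  `E := π₁^temp(𝒢) ⋊^out Π_A` of a one-vertex edgeless `𝒢`, for EVERY `ρ : Π_A →* Out π₁^temp(𝒢)`, every
  topology on `E`, every chart representative with `R.Hv v = ⊤`** (there `ι(π₁^temp(𝒢)) = ker aug` is
  normal, so the only verticial subgroup is `E`; abc-iut-f-156's `arithMaximalCompactStatementI_of_vertGp_eq_top`);
* `arithMaximalCompactStatementII_outerModel_of_edgeless` — **Thm 5.4 (ii)** at the same data in any
  COMPACT group topology on `E` (`⊤` is arithmetically ample since `aug` is onto; no branches, so no
  edge-like subgroups; abc-iut-f-156's `…II_of_vertGp_eq_top`; normality of `ι(π₁^temp(𝒢))` is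
  abc-iut-L3-d2's `range_toOuterSemidirectProduct_normal`);
* `exists_chartRepresentatives_Hv_eq_top_of_edgeless` — at the CANONICAL chart `𝒢.temperedPiChart h36` of a
  one-vertex edgeless `𝒢` such a representative EXISTS: `Hv v := range (decompHom)` is verticial
  (`PointSeq.range_decompHom_mem_verticialSubgroups`) and equals `⊤`
  (`GaloisLevelData.piPresentation_H_eq_top_of_edgeless`, p441067); so
  `arithMaximalCompactStatementI_temperedPiChart_of_edgeless` — Thm 5.4 (i) at the canonical outer model of
  every one-vertex edgeless `𝒢` satisfying `Prop36Hypotheses`, for EVERY `ρ`, with NO residual binder.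

Coverage statement for the board: {`𝒢` with an edge} ← hcof-free route (residual = design data + frame);
{`𝒢` one-vertex edgeless} ← this file, unconditionally in `ρ`.  HONEST LABEL: the edgeless case is the
"in essence vacuous" case of print's Comment (4) generalised from `Π_A = 1` to arbitrary `Π_A` and `ρ`;
nothing here bears on the substantive (edge) case; typed ≠ proved; no side taken on [IUTchIII] Cor 3.12.
-/

namespace Literature.AnabelianGeometry.SemiGraphs

namespace ProfiniteSemiGraph

open CategoryTheory Topology
open Literature.AnabelianGeometry.EtaleTheta
open scoped Pointwise

universe u u'

variable {𝒢 : ProfiniteSemiGraph.{u}} {c : TemperedPiChart 𝒢} {Gtp : Type u'} [Group Gtp]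

section OuterModel

variable {PA : Type u} [Group PA] [TopologicalSpace PA] (ρ : PA →* TopOut c.G)

/-- **[SemiAnbd] Thm 5.4 (i) at the outer model of a ONE-VERTEX EDGELESS `𝒢`, for EVERY outer action
`ρ`**, every topology on `E := π₁^temp(𝒢) ⋊^out Π_A` and every chart representative with `R.Hv v = ⊤`
(a hypothesis met at one-vertex edgeless data, `exists_chartRepresentatives_Hv_eq_top_of_edgeless`, and
only there — with an edge the vertex group is a proper subgroup of `π₁^temp(𝒢)`):
the only verticial subgroup of `E` is `E` itself (the commensurator of the normal subgroup `ker aug`),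
so every compact arithmetically ample subgroup lies in it and no two verticial subgroups are distinct.
NO residual binder — in contrast with the hcof-free route, whose residual «hUρ» forces `ρ = 1` here
(p441067). [cite: MochizukiSemiAnbd2006, Thm 5.4 (i), p. 66] -/
theorem arithMaximalCompactStatementI_outerModel_of_edgeless [Subsingleton 𝒢.graph.Vertex]
    [Nonempty 𝒢.graph.Vertex] [TopologicalSpace (outerSemidirectProduct ρ)] (R : ChartRepresentatives c)
    (hR : ∀ v, R.Hv v = ⊤) :
    ArithMaximalCompactStatementI (decompositionDataOfChart R (toOuterSemidirectProduct ρ))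
      (outerSemidirectProductSnd ρ) :=
  arithMaximalCompactStatementI_of_vertGp_eq_top _ _ fun v => by
    rw [decompositionDataOfChart_vertGp]
    exact arithVertGp_eq_top_of_Hv_eq_top R _ (range_toOuterSemidirectProduct_normal ρ) v (hR v)

/-- **[SemiAnbd] Thm 5.4 (ii) at the outer model of a ONE-VERTEX EDGELESS `𝒢`, for EVERY outer action
`ρ`**, in any COMPACT group topology on `E` and for every chart representative with `R.Hv v = ⊤`: the
arithmetically maximal compact subgroups are exactly `{E}` = the verticial subgroups, and both sides of
the second sentence are empty (no branches ⇒ no edge-like subgroups).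
[cite: MochizukiSemiAnbd2006, Thm 5.4 (ii), p. 66] -/
theorem arithMaximalCompactStatementII_outerModel_of_edgeless [Subsingleton 𝒢.graph.Vertex]
    [Nonempty 𝒢.graph.Vertex] [IsEmpty 𝒢.graph.Edge] [TopologicalSpace (outerSemidirectProduct ρ)]
    [CompactSpace (outerSemidirectProduct ρ)] (R : ChartRepresentatives c) (hR : ∀ v, R.Hv v = ⊤) :
    ArithMaximalCompactStatementII (decompositionDataOfChart R (toOuterSemidirectProduct ρ))
      (outerSemidirectProductSnd ρ) := by
  haveI : IsEmpty 𝒢.graph.Branch := ⟨fun b => isEmptyElim (𝒢.graph.edgeOf b)⟩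
  exact arithMaximalCompactStatementII_of_vertGp_eq_top _ _ (fun v => by
      rw [decompositionDataOfChart_vertGp]
      exact arithVertGp_eq_top_of_Hv_eq_top R _ (range_toOuterSemidirectProduct_normal ρ) v (hR v))
    (by -- `⊤` is arithmetically ample: `aug` is onto `Π_A` (cf. f-156's universe-0 `isArithAmple_top_outerAction`)
      unfold IsArithAmple
      rw [Subgroup.map_top_of_surjective _ (outerSemidirectProductSnd_surjective ρ), Subgroup.coe_top]
      exact isOpen_univ)

end OuterModel

/-! ### The canonical chart: a representative with `Hv v = ⊤` exists at one-vertex edgeless `𝒢` -/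

section Canonical

variable (h36 : 𝒢.Prop36Hypotheses)

/-- **At the canonical chart `𝒢.temperedPiChart h36` of a one-vertex edgeless `𝒢` there is a chart
representative with every `Hv v = π₁^temp(𝒢)`**: take `Hv v := range (decompHom)` of any compatible
point sequence over `v` (verticial, `PointSeq.range_decompHom_mem_verticialSubgroups`; equal to `⊤` by
`GaloisLevelData.piPresentation_H_eq_top_of_edgeless`, p441067) — there are no branches to represent.
[cite: MochizukiSemiAnbd2006, Thm 3.7 (i), p. 40] -/
theorem exists_chartRepresentatives_Hv_eq_top_of_edgeless [Subsingleton 𝒢.graph.Vertex]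
    [IsEmpty 𝒢.graph.Edge]
    (T : ∀ w : 𝒢.graph.Vertex, (𝒢.galoisLevelData h36).PointSeq h36.isCountable w)
    (Rb : SemiGraph.RefBranches 𝒢.graph) :
    ∃ R : ChartRepresentatives (𝒢.temperedPiChart h36), ∀ v, R.Hv v = ⊤ := by
  haveI : IsEmpty 𝒢.graph.Branch := ⟨fun b => isEmptyElim (𝒢.graph.edgeOf b)⟩
  have htop : ∀ v, ((T v).decompHom).range = ⊤ := fun v => by
    rw [← (𝒢.galoisLevelData h36).piPresentation_H h36.isCountable T Rb v]
    exact (𝒢.galoisLevelData h36).piPresentation_H_eq_top_of_edgeless h36.isCountable T Rb v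
  refine ⟨{ Hv := fun v => ((T v).decompHom).range
            Hv_mem := fun v => (T v).range_decompHom_mem_verticialSubgroups
            Hb := fun b => isEmptyElim b
            Hb_mem := fun b => isEmptyElim b
            Hb_le := fun b => isEmptyElim b }, htop⟩

/-- **[SemiAnbd] Thm 5.4 (i) at the CANONICAL outer model `π₁^temp(𝒢) ⋊^out Π_A` of every one-vertex
edgeless `𝒢` satisfying `Prop36Hypotheses`, for EVERY outer action `ρ` and every topology on the outer
model** — at the chart representative of `exists_chartRepresentatives_Hv_eq_top_of_edgeless`; no residual
binder. [cite: MochizukiSemiAnbd2006, Thm 5.4 (i), p. 66] -/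
theorem arithMaximalCompactStatementI_temperedPiChart_of_edgeless [Subsingleton 𝒢.graph.Vertex]
    [Nonempty 𝒢.graph.Vertex] [IsEmpty 𝒢.graph.Edge]
    (T : ∀ w : 𝒢.graph.Vertex, (𝒢.galoisLevelData h36).PointSeq h36.isCountable w)
    (Rb : SemiGraph.RefBranches 𝒢.graph)
    {PA : Type u} [Group PA] [TopologicalSpace PA] (ρ : PA →* TopOut (𝒢.temperedPiChart h36).G)
    [TopologicalSpace (outerSemidirectProduct ρ)] :
    ∃ R : ChartRepresentatives (𝒢.temperedPiChart h36), (∀ v, R.Hv v = ⊤) ∧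
      ArithMaximalCompactStatementI (decompositionDataOfChart R (toOuterSemidirectProduct ρ))
        (outerSemidirectProductSnd ρ) := by
  obtain ⟨R, hR⟩ := exists_chartRepresentatives_Hv_eq_top_of_edgeless h36 T Rb
  exact ⟨R, hR, arithMaximalCompactStatementI_outerModel_of_edgeless ρ R hR⟩

end Canonical

end ProfiniteSemiGraph

end Literature.AnabelianGeometry.SemiGraphs
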